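import Summits.HubbardSuperconductivity.HubbardSuperconductivity.Theorems.MesoscopicPairOrder.Negative.NoSaturationWindow

/-!
# Crux `MesoscopicPairOrder` (item `stmt-HubbardSuperconductivity-7331`): the quantitative ferromagnet gap
# below the single-flip threshold

Negative-side support (lead c7, line `pointwise_split`), fourth file. The proof of
`NoSaturationWindow.not_saturated_of_flip` is quantitative: at finite `L`, if fewer than `2n` Bloch modes
lie strictly below `E*`, then the fully polarised sector `(2n, S^z = n)` (the free spinless band) lies at
least `4 + E* - U(2n-1)/L²` ABOVE the `(2n, S^z = 0)` sector energy of `hubbardTorus 2 L 1 U`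
(`minEnergyOn_zero_add_gap_le_top`) — an `L`-uniform margin. This is the form in which the sibling
cruxes consume the ferromagnetic hazard: `LowEnergyRigidity/Negative/FerromagnetExclusion.lean` asks a
witness to keep the saturated ferromagnet more than `κ` above `E_min(N_L, 0)`; below the single-flip
threshold this holds with `κ = 4 + E* - U(1-δ) + o(1)`. Nothing here proves or refutes the crux.
Sources: H. Tasaki, Prog. Theor. Phys. 99 (1998) 489, Thm 3.2; E. H. Lieb, PRL 62 (1989) 1201.
No definition, no named fact.
-/

noncomputable section

-- the summit namespace repeats the problem name by design (D-0017)
set_option linter.dupNamespace false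

namespace Summit.HubbardSuperconductivity.HubbardSuperconductivity.Theorems.MesoscopicPairOrder.Negative

open Matrix Finset Filter
open Literature.Probability.LatticeModels Literature.MathematicalPhysics.QuantumLattice
open scoped ComplexOrder ComplexConjugate

variable {L : ℕ} [NeZero L]

/-- **Quantitative ferromagnet gap (finite `L`).** Let `L ≥ 3`, `1 ≤ n`, `2n ≤ L²`, and suppose fewer
than `2n` Bloch modes lie strictly below `E*`. Then
`E_min(2n, S^z = 0) + (4 + E* - U(2n-1)/L²) ≤ E_min(2n, S^z = n)`: the saturated ferromagnet (free
spinless band) sits at least the single-flip gain above the sector ground energy. Proof: top-sector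
ground state `φ`, occupied mode `p` with `ε_L(p) ≥ E*` (`exists_mode_ge_of_card_lt`), flip state
(`minEnergyOn_flipSector_le`), `SU(2)` descent (`minEnergyOn_szSector_zero_le`). [folklore] -/
theorem minEnergyOn_zero_add_gap_le_top (hL : 3 ≤ L) (U : ℝ) {n : ℕ} (hn1 : 1 ≤ n) (hn : 2 * n ≤ L ^ 2)
    {Es : ℝ} (hcount : (univ.filter fun k : TorusSite 2 L => torusBand L k < Es).card < 2 * n) :
    (hubbardTorus 2 L 1 U).minEnergyOn (szSector (2 * n) 0) + (4 + Es - U * (2 * n - 1) / (L : ℝ) ^ 2) ≤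
      (hubbardTorus 2 L 1 U).minEnergyOn (szSector (2 * n) (((2 * n : ℕ) : ℝ) / 2)) := by
  obtain ⟨⟨φ, hφ, hφ0, hHφ⟩, -⟩ := SsbToEvenTorusLro.Negative.top_sector_groundState U L (2 * n) hn
  have hsec : IsInSector (2 * n) 0 φ := isInSector_top_of_mem hφ
  obtain ⟨p, hp, hpφ⟩ := exists_mode_ge_of_card_lt hsec hφ0 hcount
  obtain ⟨m, hm⟩ : ∃ m : ℕ, m = 2 * n - 1 := ⟨_, rfl⟩
  have hm1 : m + 1 = 2 * n := by omega
  have hsec' : IsInSector (m + 1) 0 φ := by rwa [hm1]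
  have hmL : m ≤ L ^ 2 := by omega
  have hflip := minEnergyOn_flipSector_le hL U _ hmL hsec' hHφ hpφ
  have hdesc := minEnergyOn_szSector_zero_le (L := L) U (n := n) (d := n - 1) (by omega) (by omega)
  rw [show n + (n - 1) = m by omega, show n - (n - 1) = 1 by omega, Nat.cast_one] at hdesc
  have hmr : (m : ℝ) = 2 * n - 1 := by
    rw [hm, Nat.cast_sub (by omega)]
    push_cast
    ring
  have hchain := hdesc.trans hflip
  rw [hmr] at hchain
  linarith

/-- The same gap against ANY vector of the fully polarised sector: for a unit `v ∈ szSector (2n) n`,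
`E_min(2n, 0) + (4 + E* - U(2n-1)/L²) ≤ Re⟨v, H v⟩`. [folklore] -/
theorem minEnergyOn_zero_add_gap_le_re_expect_top (hL : 3 ≤ L) (U : ℝ) {n : ℕ} (hn1 : 1 ≤ n)
    (hn : 2 * n ≤ L ^ 2) {Es : ℝ}
    (hcount : (univ.filter fun k : TorusSite 2 L => torusBand L k < Es).card < 2 * n)
    {v : Fock (Orb (FermionTorus 2 L))} (hv : v ∈ szSector (2 * n) (((2 * n : ℕ) : ℝ) / 2))
    (hv1 : star v ⬝ᵥ v = 1) :
    (hubbardTorus 2 L 1 U).minEnergyOn (szSector (2 * n) 0) + (4 + Es - U * (2 * n - 1) / (L : ℝ) ^ 2) ≤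
      (star v ⬝ᵥ (hubbardTorus 2 L 1 U *ᵥ v)).re :=
  (minEnergyOn_zero_add_gap_le_top hL U hn1 hn hcount).trans
    ((SsbToEvenTorusLro.Negative.top_sector_groundState U L (2 * n) hn).2 v hv hv1)

end Summit.HubbardSuperconductivity.HubbardSuperconductivity.Theorems.MesoscopicPairOrder.Negative
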